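import Summits.NavierStokesRegularity.NavierStokesRegularity.Theses.CoreLogGas
import HarnessLib.Audit

/-!
# Birth skeleton (BC3) of the crux `CoreLogGas.BlowupIsLocallyDriven`

(crux item `stmt-NavierStokesRegularity-11291`, rank 4, route `route-NavierStokesRegularity-CoreLogGas`;
tree path `Cruxes/BlowupIsLocallyDriven/Lines/birth.lean`; registrar
`planner-skel-stmt-NavierStokesRegularity-11291-0`, 2026-08-17. The route predates the Lean birth
certificate; this file supplies BC3 retroactively. No `Disproof.lean` is filed for this crux yet
(`ledger crux ls`: no workfiles), so there is no `_false_without_` obstruction to honour.)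

THE CRUX (B). Every maximal finite-energy classical solution from Clay data admits `M ≥ 1`, `t₀ < T` and an
integrable `g` such that at every DEEP near-maximum vorticity point `x` (|ω(t,x)| ≥ ½ sup|ω(t)|) with canonical
core radius `ρ` (an inscribed quarter-max ball, at least half the largest such), the SYMMETRIC part of
`∇u(t,x) − ∇(BS[1_{B(x,Mρ)} ω(t)])(x)` — the strain induced at the peak by ALL vorticity outside `M` core
radii — is `≤ g(t)`.

THE CUT (exactly the layer-2 seam the route header names: "the energy inequality is used only far from the
core (∫₀ᵀ‖ω‖₂ dt < ∞ bounds the far-field strain in layer 2)"). The exterior `{|y − x| ≥ Mρ}` is split at a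
fixed macroscopic radius `R` into the FAR FIELD `{|y − x| ≥ R}` and the INTERMEDIATE SHELL `{Mρ ≤ |y − x| < R}`:

* `stub_farFieldStrain` [L; harmonic analysis, no Navier–Stokes]: for a `C²`, divergence-free, square-integrable
  field `v` with square-integrable gradient, `v = BS[curl v]` (Biot–Savart representation: `v − BS[curl v]` is
  curl- and divergence-free, hence harmonic, and lies in `L² + L⁶`), so `∇v(x) − ∇(BS[1_{B(x,R)} curl v])(x) =
  ∇(BS[1_{B(x,R)ᶜ} curl v])(x)`, and the off-diagonal kernel bound `‖∇K‖_{L²(|z| ≥ R)} = c R^{-3/2}` with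
  Cauchy–Schwarz gives `|⟪(∇v(x) − ∇BS_R(x)) e, e⟫| ≤ C ‖∇v‖₂ / R^{3/2}`, `C` absolute (scaling). Why it might
  fail: only through a typing slip (it is a theorem of potential theory); the Lean size is the Biot–Savart
  representation and differentiation of the truncated singular integral at the centre.
* `stub_enstrophyControl` [L; Navier–Stokes regularity theory]: a classical solution on `[0,T)` which is
  Leray–Hopf from a rapidly decaying datum has FINITE ENSTROPHY AT EVERY `t < T` (weak–strong uniqueness
  identifies it with the strong solution, whose `H¹` norm is continuous up to its maximal time, and that time is
  `≥ T` because blow-up at spatial infinity is excluded for decaying data — CKN far out — exactly the named-fact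
  reasoning the route's junk audit already accepted for `⨆‖ω(t,·)‖`), and `t ↦ ‖∇u(t)‖₂` is integrable on `[0,T)`
  (energy inequality: the weak gradient is the classical one, `∫₀ᵀ‖∇u‖₂² ≤ ‖u₀‖₂²/(2ν)`, Cauchy–Schwarz on a finite
  interval). Why it might fail: the EVERY-`t` clause needs the strong-solution identification, not just the a.e.
  information in `IsLerayHopfOn`.
* `stub_intermediateZone` [XL, OPEN — the structural content of B, now freed of the energy-class tail]: for every
  maximal solution there are `M ≥ 1`, `t₀ < T`, `R > 0` and an integrable `g₁` such that at every deep peak point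
  with canonical radius `ρ`, `Mρ ≤ R`, the strain at `x` of the vorticity in the SHELL `B(x,R) ∖ B(x,Mρ)`, i.e. the
  symmetric part of `∇(BS[1_{B(x,R)}ω])(x) − ∇(BS[1_{B(x,Mρ)}ω])(x)`, is `≤ g₁(t)`. This is where tube / tight
  binary / blob versus SHEET lives (a collapsing sheet strains its own peak from beyond `Mρ` inside `B(x,R)` at the
  non-integrable rate `~|ω|_max/M`): the route's declared failure mode, and the refuter's fixed-`M` objection
  (EVIDENCE_11291.md: binaries/blobs at fixed `M`), both bite HERE and only here.

`BlowupIsLocallyDriven_of : Theses.CoreLogGas.BlowupIsLocallyDriven` is the skeleton theorem (A12 shape: the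
crux BY NAME, no `Prop` hypotheses, the three stubs used by name). The glue is real (≈ 45 lines, in
`BlowupIsLocallyDriven_of_hyps`, CLOSED — the stub statements enter as hypotheses, its conclusion is the crux
body verbatim): take `M, t₀, R, g₁` from the shell stub and `C` from the far-field stub, set
`g := |g₁| + C‖∇u(t)‖₂/R^{3/2}` (integrable on `[t₀,T)` by the enstrophy stub); at an admissible `(t,x,ρ,e)` with
`Mρ ≤ R` split `∇u − ∇BS_{Mρ} = (∇u − ∇BS_R) + (∇BS_R − ∇BS_{Mρ})` and add the two bounds; when `Mρ > R` the
far-field stub applies directly at radius `Mρ` and `C‖∇u‖₂/(Mρ)^{3/2} ≤ C‖∇u‖₂/R^{3/2}`. The same composition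
with the crux written BY NAME as conclusion is the registrar's evidence file
`bc/BlowupIsLocallyDriven_birth_closed.lean` (sorry-free, axioms `propext / Classical.choice / Quot.sound`).

BC3 PROBES (`bc/probe_stub_*.lean`): for each stub `S`, `S → BlowupIsLocallyDriven` and
`S → NavierStokesRegularity` by `first | exact? | simpa | aesop` FAIL (quoted in NOTES.md / Lines/birth.md):
no stub is cheaply the crux or the summit.
-/

noncomputable section

open Set MeasureTheory Filter Topology

namespace Summit.NavierStokesRegularity.NavierStokesRegularity.Cruxes.BlowupIsLocallyDriven.Birth

set_option linter.unusedVariables false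
set_option linter.dupNamespace false

/-- **stub 1 — `stub_farFieldStrain` (L; potential theory).** Far-field Biot–Savart strain bound: for a `C²`
divergence-free `v ∈ L²` with `∇v ∈ L²`, the symmetric part of `∇v(x) − ∇(BS[1_{B(x,R)} curl v])(x)` (the
gradient induced at `x` by the vorticity outside `B(x,R)`, via `v = BS[curl v]`) is at most
`C ‖∇v‖₂ / R^{3/2}`, `C` an absolute constant. The Biot–Savart velocity is written out exactly as in the crux. -/
theorem stub_farFieldStrain :
    ∃ C : ℝ, 0 ≤ C ∧ ∀ (v : EuclideanSpace ℝ (Fin 3) → EuclideanSpace ℝ (Fin 3)),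
      ContDiff ℝ 2 v → Literature.Analysis.FluidPDE.VectorCalculus.IsDivFree v →
      MeasureTheory.MemLp v 2 MeasureTheory.volume →
      MeasureTheory.Integrable (fun y => ‖fderiv ℝ v y‖ ^ 2) MeasureTheory.volume →
      ∀ (R : ℝ), 0 < R → ∀ (x e : EuclideanSpace ℝ (Fin 3)), ‖e‖ = 1 →
        |inner ℝ ((fderiv ℝ v x - fderiv ℝ (fun z : EuclideanSpace ℝ (Fin 3) => ∫ y, (4 * Real.pi * ‖z - y‖ ^ 3)⁻¹ • Literature.Analysis.FluidPDE.cross ((Metric.ball x R).indicator (Literature.Analysis.FluidPDE.curl v) y) (z - y)) x) e) e|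
          ≤ C * Real.sqrt (∫ y, ‖fderiv ℝ v y‖ ^ 2) / R ^ (3 / 2 : ℝ) := by
  sorry

/-- **stub 2 — `stub_enstrophyControl` (L; Navier–Stokes regularity theory).** A classical solution on `[0,T)`
which is Leray–Hopf from a rapidly decaying datum has finite enstrophy `∫‖∇u(t)‖² < ∞` at EVERY `t ∈ [0,T)`
(strong-solution identification by weak–strong uniqueness; no blow-up at spatial infinity), and
`t ↦ ‖∇u(t)‖₂` is integrable on `[0,T)` (energy inequality + Cauchy–Schwarz in time). -/
theorem stub_enstrophyControl :
    ∀ (ν T : ℝ), 0 < ν → 0 < T →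
    ∀ (u : ℝ → EuclideanSpace ℝ (Fin 3) → EuclideanSpace ℝ (Fin 3)) (p : ℝ → EuclideanSpace ℝ (Fin 3) → ℝ),
      Literature.Analysis.FluidPDE.IsClassicalNSSolutionOn (Set.Ico 0 T) ν 0 u p →
      Literature.Analysis.FluidPDE.IsLerayHopfOn T ν 0 (u 0) u →
      Literature.Analysis.FluidPDE.HasRapidSpatialDecay (u 0) →
      (∀ t ∈ Set.Ico 0 T, MeasureTheory.Integrable (fun y => ‖fderiv ℝ (u t) y‖ ^ 2) MeasureTheory.volume) ∧
      MeasureTheory.IntegrableOn (fun t => Real.sqrt (∫ y, ‖fderiv ℝ (u t) y‖ ^ 2)) (Set.Ico 0 T) MeasureTheory.volume := by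
  sorry

/-- **stub 3 — `stub_intermediateZone` (XL, OPEN; the structural content of the crux).** INTERMEDIATE-SHELL
LOCALITY: for every maximal finite-energy classical solution from Clay data there are `M ≥ 1`, `t₀ < T`, a
macroscopic radius `R > 0` and an integrable `g₁` on `[t₀,T)` such that at every deep near-maximum vorticity
point `x` with canonical core radius `ρ` (same clauses as the crux) and `Mρ ≤ R`, the symmetric part of the
gradient induced at `x` by the vorticity in the shell `B(x,R) ∖ B(x,Mρ)` — written as the difference of the two
truncated Biot–Savart gradients — is `≤ g₁(t)`. Tubes, tight binaries and blobs versus collapsing SHEETS is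
decided here. -/
theorem stub_intermediateZone :
    ∀ (ν T : ℝ), 0 < ν → 0 < T →
    ∀ (u : ℝ → EuclideanSpace ℝ (Fin 3) → EuclideanSpace ℝ (Fin 3)) (p : ℝ → EuclideanSpace ℝ (Fin 3) → ℝ),
      Literature.Analysis.FluidPDE.IsMaximalSmoothSolution ν 0 u p T →
      Literature.Analysis.FluidPDE.IsLerayHopfOn T ν 0 (u 0) u →
      Literature.Analysis.FluidPDE.HasRapidSpatialDecay (u 0) →
      ∃ (M t₀ R : ℝ) (g₁ : ℝ → ℝ), 1 ≤ M ∧ 0 ≤ t₀ ∧ t₀ < T ∧ 0 < R ∧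
        MeasureTheory.IntegrableOn g₁ (Set.Ico t₀ T) ∧
        ∀ t ∈ Set.Ico t₀ T, ∀ (x : EuclideanSpace ℝ (Fin 3)) (ρ : ℝ), 0 < ρ → M * ρ ≤ R →
          (⨆ z, ‖Literature.Analysis.FluidPDE.curl (u t) z‖) ≤ 2 * ‖Literature.Analysis.FluidPDE.curl (u t) x‖ →
          Metric.ball x ρ ⊆ {y | (⨆ z, ‖Literature.Analysis.FluidPDE.curl (u t) z‖) ≤ 4 * ‖Literature.Analysis.FluidPDE.curl (u t) y‖} →
          (∀ (x' : EuclideanSpace ℝ (Fin 3)) (ρ' : ℝ),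
            (⨆ z, ‖Literature.Analysis.FluidPDE.curl (u t) z‖) ≤ 2 * ‖Literature.Analysis.FluidPDE.curl (u t) x'‖ →
            Metric.ball x' ρ' ⊆ {y | (⨆ z, ‖Literature.Analysis.FluidPDE.curl (u t) z‖) ≤ 4 * ‖Literature.Analysis.FluidPDE.curl (u t) y‖} →
            ρ' ≤ 2 * ρ) →
          ∀ e : EuclideanSpace ℝ (Fin 3), ‖e‖ = 1 →
            |inner ℝ ((fderiv ℝ (fun z : EuclideanSpace ℝ (Fin 3) => ∫ y, (4 * Real.pi * ‖z - y‖ ^ 3)⁻¹ • Literature.Analysis.FluidPDE.cross ((Metric.ball x R).indicator (Literature.Analysis.FluidPDE.curl (u t)) y) (z - y)) x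
              - fderiv ℝ (fun z : EuclideanSpace ℝ (Fin 3) => ∫ y, (4 * Real.pi * ‖z - y‖ ^ 3)⁻¹ • Literature.Analysis.FluidPDE.cross ((Metric.ball x (M * ρ)).indicator (Literature.Analysis.FluidPDE.curl (u t)) y) (z - y)) x) e) e|
              ≤ g₁ t := by
  sorry

/-- Three-term split of a quadratic form: `A − C = (A − B) + (B − C)`. -/
theorem abs_inner_sub_le_split
    (A B C : EuclideanSpace ℝ (Fin 3) →L[ℝ] EuclideanSpace ℝ (Fin 3)) (e : EuclideanSpace ℝ (Fin 3)) :
    |inner ℝ ((A - C) e) e| ≤ |inner ℝ ((A - B) e) e| + |inner ℝ ((B - C) e) e| := by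
  have h : (A - C) e = (A - B) e + (B - C) e := by
    change A e - C e = (A e - B e) + (B e - C e); abel
  rw [h, inner_add_left]
  exact abs_add_le _ _

/-- **Birth composition, CLOSED form.** The three stub STATEMENTS imply the crux (its body verbatim; the by-name
form is `BlowupIsLocallyDriven_of` below). Real glue: `g := |g₁| + C‖∇u(t)‖₂/R^{3/2}`; far/shell split when
`Mρ ≤ R`, far-field bound at radius `Mρ` and monotonicity of `R ↦ R^{-3/2}` otherwise. -/
theorem BlowupIsLocallyDriven_of_hyps
    (hF : ∃ C : ℝ, 0 ≤ C ∧ ∀ (v : EuclideanSpace ℝ (Fin 3) → EuclideanSpace ℝ (Fin 3)),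
      ContDiff ℝ 2 v → Literature.Analysis.FluidPDE.VectorCalculus.IsDivFree v →
      MeasureTheory.MemLp v 2 MeasureTheory.volume →
      MeasureTheory.Integrable (fun y => ‖fderiv ℝ v y‖ ^ 2) MeasureTheory.volume →
      ∀ (R : ℝ), 0 < R → ∀ (x e : EuclideanSpace ℝ (Fin 3)), ‖e‖ = 1 →
        |inner ℝ ((fderiv ℝ v x - fderiv ℝ (fun z : EuclideanSpace ℝ (Fin 3) => ∫ y, (4 * Real.pi * ‖z - y‖ ^ 3)⁻¹ • Literature.Analysis.FluidPDE.cross ((Metric.ball x R).indicator (Literature.Analysis.FluidPDE.curl v) y) (z - y)) x) e) e|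
          ≤ C * Real.sqrt (∫ y, ‖fderiv ℝ v y‖ ^ 2) / R ^ (3 / 2 : ℝ))
    (hE : ∀ (ν T : ℝ), 0 < ν → 0 < T →
    ∀ (u : ℝ → EuclideanSpace ℝ (Fin 3) → EuclideanSpace ℝ (Fin 3)) (p : ℝ → EuclideanSpace ℝ (Fin 3) → ℝ),
      Literature.Analysis.FluidPDE.IsClassicalNSSolutionOn (Set.Ico 0 T) ν 0 u p →
      Literature.Analysis.FluidPDE.IsLerayHopfOn T ν 0 (u 0) u →
      Literature.Analysis.FluidPDE.HasRapidSpatialDecay (u 0) →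
      (∀ t ∈ Set.Ico 0 T, MeasureTheory.Integrable (fun y => ‖fderiv ℝ (u t) y‖ ^ 2) MeasureTheory.volume) ∧
      MeasureTheory.IntegrableOn (fun t => Real.sqrt (∫ y, ‖fderiv ℝ (u t) y‖ ^ 2)) (Set.Ico 0 T) MeasureTheory.volume)
    (hI : ∀ (ν T : ℝ), 0 < ν → 0 < T →
    ∀ (u : ℝ → EuclideanSpace ℝ (Fin 3) → EuclideanSpace ℝ (Fin 3)) (p : ℝ → EuclideanSpace ℝ (Fin 3) → ℝ),
      Literature.Analysis.FluidPDE.IsMaximalSmoothSolution ν 0 u p T →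
      Literature.Analysis.FluidPDE.IsLerayHopfOn T ν 0 (u 0) u →
      Literature.Analysis.FluidPDE.HasRapidSpatialDecay (u 0) →
      ∃ (M t₀ R : ℝ) (g₁ : ℝ → ℝ), 1 ≤ M ∧ 0 ≤ t₀ ∧ t₀ < T ∧ 0 < R ∧
        MeasureTheory.IntegrableOn g₁ (Set.Ico t₀ T) ∧
        ∀ t ∈ Set.Ico t₀ T, ∀ (x : EuclideanSpace ℝ (Fin 3)) (ρ : ℝ), 0 < ρ → M * ρ ≤ R →
          (⨆ z, ‖Literature.Analysis.FluidPDE.curl (u t) z‖) ≤ 2 * ‖Literature.Analysis.FluidPDE.curl (u t) x‖ →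
          Metric.ball x ρ ⊆ {y | (⨆ z, ‖Literature.Analysis.FluidPDE.curl (u t) z‖) ≤ 4 * ‖Literature.Analysis.FluidPDE.curl (u t) y‖} →
          (∀ (x' : EuclideanSpace ℝ (Fin 3)) (ρ' : ℝ),
            (⨆ z, ‖Literature.Analysis.FluidPDE.curl (u t) z‖) ≤ 2 * ‖Literature.Analysis.FluidPDE.curl (u t) x'‖ →
            Metric.ball x' ρ' ⊆ {y | (⨆ z, ‖Literature.Analysis.FluidPDE.curl (u t) z‖) ≤ 4 * ‖Literature.Analysis.FluidPDE.curl (u t) y‖} →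
            ρ' ≤ 2 * ρ) →
          ∀ e : EuclideanSpace ℝ (Fin 3), ‖e‖ = 1 →
            |inner ℝ ((fderiv ℝ (fun z : EuclideanSpace ℝ (Fin 3) => ∫ y, (4 * Real.pi * ‖z - y‖ ^ 3)⁻¹ • Literature.Analysis.FluidPDE.cross ((Metric.ball x R).indicator (Literature.Analysis.FluidPDE.curl (u t)) y) (z - y)) x
              - fderiv ℝ (fun z : EuclideanSpace ℝ (Fin 3) => ∫ y, (4 * Real.pi * ‖z - y‖ ^ 3)⁻¹ • Literature.Analysis.FluidPDE.cross ((Metric.ball x (M * ρ)).indicator (Literature.Analysis.FluidPDE.curl (u t)) y) (z - y)) x) e) e|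
              ≤ g₁ t) :
    ∀ (ν T : ℝ), 0 < ν → 0 < T → ∀ (u : ℝ → EuclideanSpace ℝ (Fin 3) → EuclideanSpace ℝ (Fin 3)) (p : ℝ → EuclideanSpace ℝ (Fin 3) → ℝ), Literature.Analysis.FluidPDE.IsMaximalSmoothSolution ν 0 u p T → Literature.Analysis.FluidPDE.IsLerayHopfOn T ν 0 (u 0) u → Literature.Analysis.FluidPDE.HasRapidSpatialDecay (u 0) → ∃ (M t₀ : ℝ) (g : ℝ → ℝ), 1 ≤ M ∧ 0 ≤ t₀ ∧ t₀ < T ∧ MeasureTheory.IntegrableOn g (Set.Ico t₀ T) ∧ ∀ t ∈ Set.Ico t₀ T, ∀ (x : EuclideanSpace ℝ (Fin 3)) (ρ : ℝ), 0 < ρ → (⨆ z, ‖Literature.Analysis.FluidPDE.curl (u t) z‖) ≤ 2 * ‖Literature.Analysis.FluidPDE.curl (u t) x‖ → Metric.ball x ρ ⊆ {y | (⨆ z, ‖Literature.Analysis.FluidPDE.curl (u t) z‖) ≤ 4 * ‖Literature.Analysis.FluidPDE.curl (u t) y‖} → (∀ (x' : EuclideanSpace ℝ (Fin 3)) (ρ'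 : ℝ), (⨆ z, ‖Literature.Analysis.FluidPDE.curl (u t) z‖) ≤ 2 * ‖Literature.Analysis.FluidPDE.curl (u t) x'‖ → Metric.ball x' ρ' ⊆ {y | (⨆ z, ‖Literature.Analysis.FluidPDE.curl (u t) z‖) ≤ 4 * ‖Literature.Analysis.FluidPDE.curl (u t) y‖} → ρ' ≤ 2 * ρ) → ∀ e : EuclideanSpace ℝ (Fin 3), ‖e‖ = 1 → |inner ℝ ((fderiv ℝ (u t) x - fderiv ℝ (fun z : EuclideanSpace ℝ (Fin 3) => ∫ y, (4 * Real.pi * ‖z - y‖ ^ 3)⁻¹ • Literature.Analysis.FluidPDE.cross ((Metric.ball x (M * ρ)).indicator (Literature.Analysis.FluidPDE.curl (u t)) y) (z - y)) x) e) e| ≤ g t := by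
  intro ν T hν hT u p hmax hlh hdec
  obtain ⟨C, hC0, hC⟩ := hF
  have hcl : Literature.Analysis.FluidPDE.IsClassicalNSSolutionOn (Set.Ico 0 T) ν 0 u p := hmax.1
  obtain ⟨hint, hsq⟩ := hE ν T hν hT u p hcl hlh hdec
  obtain ⟨M, t₀, R, g₁, hM, ht₀, ht₀T, hR, hg₁, hH⟩ := hI ν T hν hT u p hmax hlh hdec
  refine ⟨M, t₀, fun t => |g₁ t| + C * Real.sqrt (∫ y, ‖fderiv ℝ (u t) y‖ ^ 2) / R ^ (3 / 2 : ℝ),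
    hM, ht₀, ht₀T, ?_, ?_⟩
  · -- integrability of g on [t₀, T)
    have hsub : Set.Ico t₀ T ⊆ Set.Ico 0 T := Set.Ico_subset_Ico_left ht₀
    have hN : MeasureTheory.IntegrableOn (fun t => Real.sqrt (∫ y, ‖fderiv ℝ (u t) y‖ ^ 2)) (Set.Ico t₀ T)
        MeasureTheory.volume := hsq.mono_set hsub
    exact hg₁.integrable.abs.add ((hN.integrable.const_mul C).div_const _)
  · intro t ht x ρ hρ hpeak hball hmaxrad e he
    -- classical facts at the time slice t
    have ht' : t ∈ Set.Ico 0 T := ⟨ht₀.trans ht.1, ht.2⟩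
    have hC2 : ContDiff ℝ 2 (u t) := (hcl.contDiff_velocity ht').of_le (WithTop.coe_le_coe.mpr le_top)
    have hdiv : Literature.Analysis.FluidPDE.VectorCalculus.IsDivFree (u t) := hcl.divFree t ht'
    have hL2 : MeasureTheory.MemLp (u t) 2 MeasureTheory.volume := hlh.memLp t ⟨ht'.1, ht'.2.le⟩
    have hgrad : MeasureTheory.Integrable (fun y => ‖fderiv ℝ (u t) y‖ ^ 2) MeasureTheory.volume := hint t ht'
    have hNn : 0 ≤ C * Real.sqrt (∫ y, ‖fderiv ℝ (u t) y‖ ^ 2) := mul_nonneg hC0 (Real.sqrt_nonneg _)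
    show _ ≤ |g₁ t| + C * Real.sqrt (∫ y, ‖fderiv ℝ (u t) y‖ ^ 2) / R ^ (3 / 2 : ℝ)
    by_cases hcase : M * ρ ≤ R
    · -- split the exterior at radius R: far field + intermediate shell
      have h1 := hC (u t) hC2 hdiv hL2 hgrad R hR x e he
      have h2 := (hH t ht x ρ hρ hcase hpeak hball hmaxrad e he).trans (le_abs_self (g₁ t))
      exact (abs_inner_sub_le_split _ _ _ e).trans ((add_le_add h1 h2).trans_eq (add_comm _ _))
    · -- the M-ball already contains B(x,R): the far-field bound applies directly at radius M ρ
      replace hcase : R < M * ρ := lt_of_not_ge hcase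
      have hMρ : 0 < M * ρ := mul_pos (lt_of_lt_of_le one_pos hM) hρ
      have h1 := hC (u t) hC2 hdiv hL2 hgrad (M * ρ) hMρ x e he
      have hmono : C * Real.sqrt (∫ y, ‖fderiv ℝ (u t) y‖ ^ 2) / (M * ρ) ^ (3 / 2 : ℝ)
          ≤ C * Real.sqrt (∫ y, ‖fderiv ℝ (u t) y‖ ^ 2) / R ^ (3 / 2 : ℝ) :=
        div_le_div_of_nonneg_left hNn (Real.rpow_pos_of_pos hR _)
          (Real.rpow_le_rpow hR.le hcase.le (by norm_num))
      exact h1.trans (hmono.trans (le_add_of_nonneg_left (abs_nonneg _)))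

/-- **Birth composition (the skeleton theorem, A12 shape).** The crux BY NAME from the three registered stubs,
used by name; all glue is in the closed `BlowupIsLocallyDriven_of_hyps`. -/
theorem BlowupIsLocallyDriven_of : Theses.CoreLogGas.BlowupIsLocallyDriven :=
  BlowupIsLocallyDriven_of_hyps stub_farFieldStrain stub_enstrophyControl stub_intermediateZone

end Summit.NavierStokesRegularity.NavierStokesRegularity.Cruxes.BlowupIsLocallyDriven.Birth
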